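import Summits.QuantumFields.BalabanUV.Beta.WardLocusSecondOrder

/-!
# `BalabanUV.Beta.WardLocusSecondOrderLaw` — binder row D1, hW W-side (W-L4): THE BI-VERTEX PIECE OF THE SECOND-ORDER WARD SOCKET IS THE
# FIRST HALF OF `conjW` — from the column law (hH) and a TABLE-LEVEL first-slot Ward law of the bi-table (the (T2-S₂) socket of the memo)

HONEST FRAMING (cell charter, verbatim): «discharging `BetaPertH` makes Bałaban's UV stability UNCONDITIONAL — a real constructive-QFT
result; it is NOT the continuum limit and NOT the Clay problem.»  DERIVED cell leaf (pub-balaban β sub-cell, D1 formalisation swarm seat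
`b2b-balaban-beta-d1-formalise-leaf-10`, gen 2; sequel of `WardLocusSecondOrder`; scoping memo
`HOME/b2b-balaban-beta-d1-formalise-leaf-10/g2/W-L4-SCOPING.v1.md` §2); [folklore] kernel algebra over an2's `SecondOrderResponse` carrier and
an1's `ChartConjugationReflection` exchange lemmas, cited BY NAME; 0 def, no statement of Bałaban's papers typed, no `[cite:]` tag; the
table-level law is a HYPOTHESIS (socket) — nothing of (W-L4) is discharged.  NOT `BetaPertH`, NOT continuum, NOT Clay.
HONEST DEPENDENCY (cell records, verbatim): «continuum YM on T⁴ ⇐ BetaPertH ∧ nine spine estimates (0/9 proved); BetaPertH ⇐ (D1) ∧ (D4) ∧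
CAP+tail; G-an2-4 gates asym, D1 and NE2/3/4.»
ABSOLUTE RULE (cell charter, verbatim): «No internally-minted statement may enter as a cited fact. Every hypothesis is either kernel-proved in
this package or a verbatim quotation of a PUBLISHED theorem with page reference. The manuscript(s) under audit are NOT citable for their own
disputed steps — they are the thing under adjudication; programme-internal (2001/route/tribunal) claims are never citable.»

WHAT IS HERE.  The hW W-side socket for a second-order table `W` reads `divW W y ν y′ = conjW 𝕄 0 V_{νy′} (X y) 0 (X₂ …) + Nr …`, whose
first-order half is `conjW₁ 0 V_{νy′} (X y) 0 = V_{νy′} ∘ X y − X y ∘ V_{νy′}` with `V_{νy′} = vertexOfK K N S ν y′` (an1's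
`ChartConjugation.conjW`).  `WardLocusSecondOrder.divW_vertex2OfK` (B1) reduced the pure-gauge slice of the BI-VERTEX piece
`vertex2OfK K N S₂` of an2's carrier to `cH •` the block pure-gauge contraction of the bi-table's first slot, dressed in the second.  Here
(`divW_vertex2OfK_of_tableLaw`): IF the bi-table obeys the TABLE-LEVEL FIRST-SLOT WARD LAW (the (T2-S₂) socket of the memo — for the
derivatives of a gauge-invariant Lagrangian it is the order-two consequence `A⁗[dλ, h, k, l] = −Σ A‴[ad_λ ·, ·, ·]` of invariance)
`cH • Σ_{v ∈ box} divV (fun κ u ↦ S₂ κ u κ′ u′) (N•y + v) = S κ′ u′ ∘ X y − X y ∘ S κ′ u′ + R y κ′ u′` (commutator of the FIRST-order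
table with the block rotation generator + a remainder table `R`, an1's «stripped rotated first-order vertex»), THEN
`divW (vertex2OfK K N S₂) y ν y′ = V_{νy′} ∘ X y − X y ∘ V_{νy′} + vertexOfK K N (R y) ν y′` — EXACTLY the `conjW₁` half of the
socket plus the chain-rule vertex of the remainder table (whose tadpole the parity socket `hNt` kills).  Linearity of the chain-rule vertex
in its table (finite block sums / differences, entrywise) and an1's `vertexOfK_conjV` (chain-rule vertex of a conjugated family) do the work.
The other three pieces of `W2OfK` and the `conjW₂` half are the memo's (B2)–(B4) — not here.
-/

noncomputable section

open Finset
open scoped BigOperators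
open Literature.MathematicalPhysics.QuantumFieldTheory
open Literature.MathematicalPhysics.QuantumFieldTheory.Balaban1983to89
open Literature.MathematicalPhysics.QuantumFieldTheory.Balaban1983to89.Beta
open B6BondElimination (unitVec)
open ExpKernelCalculus (MKer Decays comp)
open KernelWard (divV divW)
open AffineAveraging (box toSite)
open OneStepResolventKernel (Fib wsum LocStencil)
open OneStepKernelFamily (colH vertexOfK)
open SecondOrderResponse (vertex2OfK)
open Summit.QuantumFields.BalabanUV.Beta.TameKernelCalculus
open Summit.QuantumFields.BalabanUV.Beta.ChartConjugation (conjV)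
open Summit.QuantumFields.BalabanUV.Beta.ChartConjugationReflection (summable_abs_colH abs_le_of_locStencil vertexOfK_add vertexOfK_neg
  vertexOfK_conjV)
open Summit.QuantumFields.BalabanUV.Beta.KernelWardRelative (gaugeWt)
open Summit.QuantumFields.BalabanUV.Beta.WardLocusSecondOrder (divW_vertex2OfK)

namespace Summit.QuantumFields.BalabanUV.Beta.WardLocusSecondOrderLaw

variable {d N : ℕ}

/-! ## §1 Linearity of the chain-rule vertex in its table: block pure-gauge contractions pass inside (entrywise) -/

section Linearity

/-- [folklore] **THE BLOCK PURE-GAUGE CONTRACTION PASSES INSIDE THE CHAIN-RULE VERTEX**: for a decaying `K` and a bi-table `S₂` with a uniform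
entry bound, the block sum of coarse divergences (in the FIRST table slot) of the dressed tables `T κ u := vertexOfK K N (S₂ κ u) ν y′` is the
chain-rule vertex of the block-contracted bi-table:
`Σ_{v ∈ box} divV T (N•y + v) = vertexOfK K N (fun κ′ u′ ↦ Σ_{v ∈ box} divV (fun κ u ↦ S₂ κ u κ′ u′) (N•y + v)) ν y′`. -/
theorem sum_divV_vertexOfK_eq {K : MKer (d + 1) (Fib d)} (hK : ∃ δ C : ℝ, 0 < δ ∧ 0 ≤ C ∧ Decays K C δ)
    {S₂ : Fin (d + 1) → (Fin (d + 1) → ℤ) → Fin (d + 1) → (Fin (d + 1) → ℤ) → MKer (d + 1) (Fib d)} {B₂ : ℝ}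
    (hB₂ : ∀ κ u κ' u' x z a b, |S₂ κ u κ' u' x z a b| ≤ B₂) (y : Fin (d + 1) → ℤ) (ν : Fin (d + 1)) (y' : Fin (d + 1) → ℤ) :
    ∑ v ∈ box (d + 1) N, divV (fun κ u => vertexOfK K N (S₂ κ u) ν y') ((N : ℤ) • y + toSite v) =
      vertexOfK K N (fun κ' u' => ∑ v ∈ box (d + 1) N, divV (fun κ u => S₂ κ u κ' u') ((N : ℤ) • y + toSite v)) ν y' := by
  have hs : ∀ (κ : Fin (d + 1)) (u : Fin (d + 1) → ℤ) (κ' : Fin (d + 1)) (x z : Fin (d + 1) → ℤ) (a b : Fib d),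
      Summable fun u' => colH K N ν y' κ' u' * S₂ κ u κ' u' x z a b := fun κ u κ' x z a b =>
    Summable.of_norm_bounded ((summable_abs_colH (N := N) hK ν y' κ').mul_right B₂) (fun u' => by
      rw [Real.norm_eq_abs, abs_mul]; exact mul_le_mul_of_nonneg_left (hB₂ κ u κ' u' x z a b) (abs_nonneg _))
  funext x z a b
  simp only [Finset.sum_apply, KernelWard.divV, Pi.sub_apply, vertexOfK, OneStepResolventKernel.wsum]
  have e : ∀ κ' : Fin (d + 1), (∑' u', colH K N ν y' κ' u' *
      ∑ w ∈ box (d + 1) N, ∑ κ₁, (S₂ κ₁ ((N : ℤ) • y + toSite w - unitVec κ₁) κ' u' x z a b - S₂ κ₁ ((N : ℤ) • y + toSite w) κ' u' x z a b))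
      = ∑ w ∈ box (d + 1) N, ∑ κ₁, ((∑' u', colH K N ν y' κ' u' * S₂ κ₁ ((N : ℤ) • y + toSite w - unitVec κ₁) κ' u' x z a b) -
          ∑' u', colH K N ν y' κ' u' * S₂ κ₁ ((N : ℤ) • y + toSite w) κ' u' x z a b) := by
    intro κ'
    have h1 : ∀ u', colH K N ν y' κ' u' *
        ∑ w ∈ box (d + 1) N, ∑ κ₁, (S₂ κ₁ ((N : ℤ) • y + toSite w - unitVec κ₁) κ' u' x z a b - S₂ κ₁ ((N : ℤ) • y + toSite w) κ' u' x z a b)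
        = ∑ w ∈ box (d + 1) N, ∑ κ₁, (colH K N ν y' κ' u' * S₂ κ₁ ((N : ℤ) • y + toSite w - unitVec κ₁) κ' u' x z a b -
            colH K N ν y' κ' u' * S₂ κ₁ ((N : ℤ) • y + toSite w) κ' u' x z a b) := fun u' => by
      rw [Finset.mul_sum]
      refine Finset.sum_congr rfl fun w _ => ?_
      rw [Finset.mul_sum]
      exact Finset.sum_congr rfl fun κ₁ _ => by ring
    simp only [h1]
    rw [Summable.tsum_finsetSum (fun w _ => summable_sum fun κ₁ _ => (hs κ₁ _ κ' x z a b).sub (hs κ₁ _ κ' x z a b))]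
    refine Finset.sum_congr rfl fun w _ => ?_
    rw [Summable.tsum_finsetSum (fun κ₁ _ => (hs κ₁ _ κ' x z a b).sub (hs κ₁ _ κ' x z a b))]
    refine Finset.sum_congr rfl fun κ₁ _ => ?_
    exact (hs κ₁ _ κ' x z a b).tsum_sub (hs κ₁ _ κ' x z a b)
  simp only [e]
  symm
  rw [Finset.sum_comm]
  refine Finset.sum_congr rfl fun w _ => ?_
  rw [Finset.sum_comm]
  refine Finset.sum_congr rfl fun κ₁ _ => ?_
  rw [Finset.sum_sub_distrib]

/-- [folklore] A scalar passes inside the chain-rule vertex (entrywise; no summability needed). -/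
theorem smul_vertexOfK (c : ℝ) (K : MKer (d + 1) (Fib d)) (S : Fin (d + 1) → (Fin (d + 1) → ℤ) → MKer (d + 1) (Fib d))
    (μ : Fin (d + 1)) (y : Fin (d + 1) → ℤ) : c • vertexOfK K N S μ y = vertexOfK K N (fun κ u => c • S κ u) μ y := by
  funext x z a b
  simp only [Pi.smul_apply, smul_eq_mul, vertexOfK, OneStepResolventKernel.wsum, Finset.mul_sum, ← tsum_mul_left]
  refine Finset.sum_congr rfl fun κ' _ => tsum_congr fun u => ?_
  ring

/-- [folklore] The chain-rule vertex only sees its table: pointwise-equal tables give the same vertex. -/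
theorem vertexOfK_congr (K : MKer (d + 1) (Fib d)) {S T : Fin (d + 1) → (Fin (d + 1) → ℤ) → MKer (d + 1) (Fib d)}
    (h : ∀ κ u, S κ u = T κ u) (μ : Fin (d + 1)) (y : Fin (d + 1) → ℤ) : vertexOfK K N S μ y = vertexOfK K N T μ y := by
  have : S = T := funext fun κ => funext fun u => h κ u
  rw [this]

end Linearity

/-! ## §2 (B1) under the table-level first-slot Ward law: the `conjW₁` half of the W-socket -/

section TableLaw

variable [NeZero N]

/-- [folklore] **THE BI-VERTEX PIECE OF THE SECOND-ORDER WARD SOCKET IS THE `conjW₁` HALF**, from the ℋ-column law (hH) of `K` and a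
TABLE-LEVEL FIRST-SLOT WARD LAW of the bi-table.  Data: decaying `K` (blocking `N ≥ 1`), a LOCAL first-order table `S`, a bi-table `S₂` with a
uniform entry bound, spread block rotation generators `X y`, a bounded remainder table family `R y`.  IF (hS₂) for every coarse site `y` and table
index `(κ′, u′)`, `cH • Σ_{v ∈ box} divV (fun κ u ↦ S₂ κ u κ′ u′) (N•y + v) = S κ′ u′ ∘ X y − X y ∘ S κ′ u′ + R y κ′ u′`, THEN
`divW (vertex2OfK K N S₂) y ν y′ = vertexOfK K N S ν y′ ∘ X y − X y ∘ vertexOfK K N S ν y′ + vertexOfK K N (R y) ν y′`. -/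
theorem divW_vertex2OfK_of_tableLaw {K : MKer (d + 1) (Fib d)} (hK : ∃ δ C : ℝ, 0 < δ ∧ 0 ≤ C ∧ Decays K C δ)
    {S : Fin (d + 1) → (Fin (d + 1) → ℤ) → MKer (d + 1) (Fib d)} {Cs δs : ℝ} (hS : LocStencil S Cs δs) (hδs : 0 < δs)
    {S₂ : Fin (d + 1) → (Fin (d + 1) → ℤ) → Fin (d + 1) → (Fin (d + 1) → ℤ) → MKer (d + 1) (Fib d)} {B₂ : ℝ}
    (hB₂ : ∀ κ u κ' u' x z a b, |S₂ κ u κ' u' x z a b| ≤ B₂) (cH : ℝ)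
    (hH : ∀ (y : Fin (d + 1) → ℤ) (κ' : Fin (d + 1)) (u : Fin (d + 1) → ℤ),
      ∑ μ, (colH K N μ (y - unitVec μ) κ' u - colH K N μ y κ' u) = cH * gaugeWt N y κ' u)
    {X : (Fin (d + 1) → ℤ) → MKer (d + 1) (Fib d)} (hX : ∀ y, Spr (X y))
    {R : (Fin (d + 1) → ℤ) → Fin (d + 1) → (Fin (d + 1) → ℤ) → MKer (d + 1) (Fib d)} {BR : ℝ}
    (hR : ∀ y κ u x z a b, |R y κ u x z a b| ≤ BR)
    (hS₂ : ∀ (y : Fin (d + 1) → ℤ) (κ' : Fin (d + 1)) (u' : Fin (d + 1) → ℤ),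
      cH • ∑ v ∈ box (d + 1) N, divV (fun κ u => S₂ κ u κ' u') ((N : ℤ) • y + toSite v) =
        comp (S κ' u') (X y) - comp (X y) (S κ' u') + R y κ' u')
    (y : Fin (d + 1) → ℤ) (ν : Fin (d + 1)) (y' : Fin (d + 1) → ℤ) :
    divW (vertex2OfK K N S₂) y ν y' =
      comp (vertexOfK K N S ν y') (X y) - comp (X y) (vertexOfK K N S ν y') + vertexOfK K N (R y) ν y' := by
  -- (B1): the slice is `cH •` the block contraction of the first slot, dressed in the second; pull the block sum and the scalar inside
  rw [divW_vertex2OfK hK hB₂ cH hH y ν y', sum_divV_vertexOfK_eq hK hB₂ y ν y', smul_vertexOfK]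
  -- the table law, table index by table index; the commutator form `S∘X − X∘S = −conjV X S`
  have hlaw : ∀ κ' u', cH • ∑ v ∈ box (d + 1) N, divV (fun κ u => S₂ κ u κ' u') ((N : ℤ) • y + toSite v) =
      -conjV (X y) (S κ' u') + R y κ' u' := fun κ' u' => by
    rw [hS₂ y κ' u']
    unfold ChartConjugation.conjV
    abel
  rw [vertexOfK_congr K hlaw ν y']
  -- bounds for the additivity of the chain-rule vertex
  have hCs : ∀ κ u x z a b, |S κ u x z a b| ≤ Cs := abs_le_of_locStencil hS hδs.le
  obtain ⟨CX, δX, hδX, hXd⟩ := hX y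
  -- the conjugated family `−conjV (X y) (S κ u)` has a uniform entry bound: rows of `X y` decay, entries of `S` are bounded
  have hrow : ∀ x a, Summable fun w => ∑ f : Fib d, |X y x w a f| := fun x a =>
    summable_sum fun f _ => Summable.of_nonneg_of_le (fun w => abs_nonneg _) (fun w => hXd x w a f)
      ((ExpKernelCalculus.summable_exp_shift hδX x).mul_left CX)
  have hcol : ∀ z b, Summable fun w => ∑ f : Fib d, |X y w z f b| := fun z b =>
    summable_sum fun f _ => Summable.of_nonneg_of_le (fun w => abs_nonneg _) (fun w => hXd w z f b)
      ((ExpKernelCalculus.summable_exp_shift' hδX z).mul_left CX)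
  set BX : ℝ := (Fintype.card (Fib d) : ℝ) * CX * ExpKernelCalculus.Zl (d + 1) δX with hBX
  have hsumX : ∀ x a, (∑' w, ∑ f : Fib d, |X y x w a f|) ≤ BX := fun x a => by
    calc (∑' w, ∑ f : Fib d, |X y x w a f|) ≤ ∑' w, ∑ _f : Fib d, CX * Real.exp (-δX * B12Sec2to5.l1 (x - w)) :=
          (hrow x a).tsum_le_tsum (fun w => Finset.sum_le_sum fun f _ => hXd x w a f)
            (summable_sum fun f _ => (ExpKernelCalculus.summable_exp_shift hδX x).mul_left CX)
      _ = BX := by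
          simp only [Finset.sum_const, Finset.card_univ, nsmul_eq_mul]
          rw [tsum_mul_left, tsum_mul_left, ExpKernelCalculus.tsum_exp_shift, hBX]; ring
  have hsumX' : ∀ z b, (∑' w, ∑ f : Fib d, |X y w z f b|) ≤ BX := fun z b => by
    calc (∑' w, ∑ f : Fib d, |X y w z f b|) ≤ ∑' w, ∑ _f : Fib d, CX * Real.exp (-δX * B12Sec2to5.l1 (w - z)) :=
          (hcol z b).tsum_le_tsum (fun w => Finset.sum_le_sum fun f _ => hXd w z f b)
            (summable_sum fun f _ => (ExpKernelCalculus.summable_exp_shift' hδX z).mul_left CX)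
      _ = BX := by
          simp only [Finset.sum_const, Finset.card_univ, nsmul_eq_mul]
          rw [tsum_mul_left, tsum_mul_left, ExpKernelCalculus.tsum_exp_shift', hBX]; ring
  have hcomp₁ : ∀ κ u x z a b, |comp (X y) (S κ u) x z a b| ≤ BX * Cs := by
    intro κ u x z a b
    unfold ExpKernelCalculus.comp
    have hsw : Summable fun w => ∑ f : Fib d, |X y x w a f| * Cs := by
      simpa only [Finset.sum_mul] using (hrow x a).mul_right Cs
    have hle : ∀ w, |∑ f : Fib d, X y x w a f * S κ u w z f b| ≤ ∑ f : Fib d, |X y x w a f| * Cs := fun w =>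
      (Finset.abs_sum_le_sum_abs _ _).trans (Finset.sum_le_sum fun f _ => by
        rw [abs_mul]; exact mul_le_mul_of_nonneg_left (hCs κ u w z f b) (abs_nonneg _))
    have hs' : Summable fun w => ∑ f : Fib d, X y x w a f * S κ u w z f b :=
      Summable.of_norm_bounded hsw (fun w => by rw [Real.norm_eq_abs]; exact hle w)
    calc |∑' w, ∑ f : Fib d, X y x w a f * S κ u w z f b| ≤ ∑' w, |∑ f : Fib d, X y x w a f * S κ u w z f b| := by
          rw [← Real.norm_eq_abs]; exact norm_tsum_le_tsum_norm hs'.abs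
      _ ≤ ∑' w, ∑ f : Fib d, |X y x w a f| * Cs := hs'.abs.tsum_le_tsum hle hsw
      _ = (∑' w, ∑ f : Fib d, |X y x w a f|) * Cs := by rw [← tsum_mul_right]; exact tsum_congr fun w => by rw [Finset.sum_mul]
      _ ≤ BX * Cs := mul_le_mul_of_nonneg_right (hsumX x a) ((abs_nonneg _).trans (hCs 0 0 0 0 (Sum.inl 0) (Sum.inl 0)))
  have hcomp₂ : ∀ κ u x z a b, |comp (S κ u) (X y) x z a b| ≤ BX * Cs := by
    intro κ u x z a b
    unfold ExpKernelCalculus.comp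
    have hsw : Summable fun w => ∑ f : Fib d, |X y w z f b| * Cs := by
      simpa only [Finset.sum_mul] using (hcol z b).mul_right Cs
    have hle : ∀ w, |∑ f : Fib d, S κ u x w a f * X y w z f b| ≤ ∑ f : Fib d, |X y w z f b| * Cs := fun w =>
      (Finset.abs_sum_le_sum_abs _ _).trans (Finset.sum_le_sum fun f _ => by
        rw [abs_mul, mul_comm]; exact mul_le_mul_of_nonneg_left (hCs κ u x w a f) (abs_nonneg _))
    have hs' : Summable fun w => ∑ f : Fib d, S κ u x w a f * X y w z f b :=
      Summable.of_norm_bounded hsw (fun w => by rw [Real.norm_eq_abs]; exact hle w)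
    calc |∑' w, ∑ f : Fib d, S κ u x w a f * X y w z f b| ≤ ∑' w, |∑ f : Fib d, S κ u x w a f * X y w z f b| := by
          rw [← Real.norm_eq_abs]; exact norm_tsum_le_tsum_norm hs'.abs
      _ ≤ ∑' w, ∑ f : Fib d, |X y w z f b| * Cs := hs'.abs.tsum_le_tsum hle hsw
      _ = (∑' w, ∑ f : Fib d, |X y w z f b|) * Cs := by rw [← tsum_mul_right]; exact tsum_congr fun w => by rw [Finset.sum_mul]
      _ ≤ BX * Cs := mul_le_mul_of_nonneg_right (hsumX' z b) ((abs_nonneg _).trans (hCs 0 0 0 0 (Sum.inl 0) (Sum.inl 0)))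
  have hB0 : 0 ≤ BX * Cs := (abs_nonneg _).trans (hcomp₁ 0 0 0 0 (Sum.inl 0) (Sum.inl 0))
  have hBR0 : 0 ≤ BR := (abs_nonneg _).trans (hR y 0 0 0 0 (Sum.inl 0) (Sum.inl 0))
  have hconj : ∀ κ u x z a b, |(-conjV (X y) (S κ u)) x z a b| ≤ BX * Cs + BX * Cs + BR := by
    intro κ u x z a b
    simp only [Pi.neg_apply, ChartConjugation.conjV, Pi.sub_apply, abs_neg]
    calc |comp (X y) (S κ u) x z a b - comp (S κ u) (X y) x z a b|
        ≤ |comp (X y) (S κ u) x z a b| + |comp (S κ u) (X y) x z a b| := abs_sub _ _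
      _ ≤ BX * Cs + BX * Cs + BR := by linarith [hcomp₁ κ u x z a b, hcomp₂ κ u x z a b]
  have hR' : ∀ κ u x z a b, |R y κ u x z a b| ≤ BX * Cs + BX * Cs + BR := fun κ u x z a b => (hR y κ u x z a b).trans (by linarith)
  rw [vertexOfK_add hK hconj hR' ν y', vertexOfK_neg, vertexOfK_conjV hK (hX y) hS hδs ν y']
  unfold ChartConjugation.conjV
  abel

end TableLaw

end Summit.QuantumFields.BalabanUV.Beta.WardLocusSecondOrderLaw

end
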